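import Mathlib
import HarnessLib

/-!
# AM–GM minimum bound for ideals of number rings

For a nonzero `x` in an ideal `I` of the ring of integers `𝓞 K` of a number field `K` of degree
`n = [K : ℚ]`, `n · N(I)^{2/n} ≤ ∑_{σ : K → ℂ} |σ x|²`: the arithmetic–geometric mean inequality on
the `n` nonnegative reals `|σ x|²` (`σ` ranging over the `n` embeddings `K → ℂ`), combined with
`∏_σ |σ x| = |N_{K/ℚ}(x)| = N((x))`, `N(I) ∣ N((x))` (as `(x) ⊆ I`) and `N((x)) ≠ 0`.  Hence the
canonical-embedding minimum of `I` is `≥ √n · N(I)^{1/n}` — the injectivity certificate of the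
lattice leg of line `SketchIdeator5` (stub `stub_amgm`) of the crux `Target` of route LatticeMagic.
Ordinary algebraic number theory over Mathlib; no hypotheses beyond `0 ≠ x ∈ I`.
-/

set_option linter.dupNamespace false -- summit = sub-problem (D-0017)

namespace Summit.PneNP.PneNP.Theorems.LatticeMagicTarget

open NumberField

/-- `N((s)) = ∏_{σ : K → ℂ} |σ s|` for an algebraic integer `s` of a number field `K`: the absolute
norm of the principal ideal `(s)` is `|N_{K/ℚ}(s)|` (Mathlib `Ideal.absNorm_span_singleton`,
`Algebra.coe_norm_int`), and `N_{K/ℚ}(s) = ∏_σ σ s` over the `[K : ℚ]` embeddings `σ : K → ℂ`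
(Mathlib `Algebra.norm_eq_prod_embeddings`). [folklore] -/
theorem absNorm_span_singleton_eq_prod_norm_embeddings (K : Type*) [Field K] [NumberField K]
    (s : 𝓞 K) : (Ideal.absNorm (Ideal.span {s}) : ℝ) = ∏ σ : K →+* ℂ, ‖σ (s : K)‖ := by
  -- adapted from Literature.NumberTheory.DiophantineGeometry.AbcWave0GranvilleStarkHeights
  -- (`absNorm_span_singleton_eq_prod_embeddings`)
  rw [Ideal.absNorm_span_singleton]
  have h1 : ((Algebra.norm ℤ s).natAbs : ℝ) = |(Algebra.norm ℚ (s : K) : ℝ)| := by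
    rw [← Algebra.coe_norm_int, Nat.cast_natAbs, Int.cast_abs]
    push_cast
    rfl
  rw [h1]
  have h2 : ‖(algebraMap ℚ ℂ) (Algebra.norm ℚ (s : K))‖ = |(Algebra.norm ℚ (s : K) : ℝ)| := by
    rw [eq_ratCast, ← Real.norm_eq_abs, ← Complex.norm_real, Complex.ofReal_ratCast]
  rw [← h2, Algebra.norm_eq_prod_embeddings ℚ ℂ (s : K), norm_prod]
  exact (Fintype.prod_equiv RingHom.equivRatAlgHom (fun f : K →+* ℂ => ‖f (s : K)‖)
    (fun φ : K →ₐ[ℚ] ℂ => ‖φ (s : K)‖) fun _ => by simp [RingHom.equivRatAlgHom_apply]).symm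

/-- For `0 ≠ x ∈ I ⊆ 𝓞 K`, `N(I) ≤ ∏_{σ : K → ℂ} |σ x|`: `(x) ⊆ I` gives `N(I) ∣ N((x))`
(Mathlib `Ideal.absNorm_dvd_absNorm_of_le`), `N((x)) ≠ 0` as `x ≠ 0`
(Mathlib `Ideal.absNorm_eq_zero_iff`), and `N((x)) = ∏_σ |σ x|`. [folklore] -/
theorem absNorm_le_prod_norm_embeddings (K : Type*) [Field K] [NumberField K] (I : Ideal (𝓞 K))
    (x : 𝓞 K) (hx : x ∈ I) (hx0 : x ≠ 0) :
    ((Ideal.absNorm I : ℕ) : ℝ) ≤ ∏ σ : K →+* ℂ, ‖σ (x : K)‖ := by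
  rw [← absNorm_span_singleton_eq_prod_norm_embeddings K x]
  have hle : Ideal.span {x} ≤ I := (Ideal.span_singleton_le_iff_mem (I := I)).2 hx
  have hdvd : Ideal.absNorm I ∣ Ideal.absNorm (Ideal.span {x}) := Ideal.absNorm_dvd_absNorm_of_le hle
  have hne : Ideal.absNorm (Ideal.span {x}) ≠ 0 := by
    rw [Ne, Ideal.absNorm_eq_zero_iff, Ideal.span_singleton_eq_bot]
    exact hx0
  exact_mod_cast Nat.le_of_dvd (Nat.pos_of_ne_zero hne) hdvd

/-- **AM–GM with equal weights over the embeddings.** For nonnegative reals `z_σ` indexed by the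
`n = [K : ℚ] ≥ 1` embeddings `σ : K → ℂ` (Mathlib `NumberField.Embeddings.card`), the weighted
AM–GM inequality with weights `1/n` (Mathlib `Real.geom_mean_le_arith_mean_weighted`) reads
`n · (∏_σ z_σ)^{1/n} ≤ ∑_σ z_σ`. [folklore] -/
theorem finrank_mul_prod_rpow_le_sum (K : Type*) [Field K] [NumberField K]
    (z : (K →+* ℂ) → ℝ) (hz : ∀ σ, 0 ≤ z σ) :
    (Module.finrank ℚ K : ℝ) * (∏ σ : K →+* ℂ, z σ) ^ ((1 : ℝ) / (Module.finrank ℚ K : ℝ))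
      ≤ ∑ σ : K →+* ℂ, z σ := by
  set n : ℕ := Module.finrank ℚ K
  have hnpos : (0 : ℝ) < n := by exact_mod_cast (Module.finrank_pos : 0 < Module.finrank ℚ K)
  have hn0 : (n : ℝ) ≠ 0 := hnpos.ne'
  have hcard : (Finset.univ : Finset (K →+* ℂ)).card = n := by
    rw [Finset.card_univ, NumberField.Embeddings.card]
  have hw : ∑ _σ : K →+* ℂ, (1 : ℝ) / n = 1 := by
    rw [Finset.sum_const, hcard, nsmul_eq_mul, mul_one_div_cancel hn0]
  have hamgm : ∏ σ : K →+* ℂ, z σ ^ ((1 : ℝ) / n) ≤ ∑ σ : K →+* ℂ, (1 : ℝ) / n * z σ :=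
    Real.geom_mean_le_arith_mean_weighted (Finset.univ : Finset (K →+* ℂ)) (fun _ => (1 : ℝ) / n)
      z (fun _ _ => by positivity) hw (fun σ _ => hz σ)
  rw [Real.finsetProd_rpow _ _ (fun σ _ => hz σ), ← Finset.mul_sum] at hamgm
  calc (n : ℝ) * (∏ σ : K →+* ℂ, z σ) ^ ((1 : ℝ) / n)
      ≤ (n : ℝ) * ((1 : ℝ) / n * ∑ σ : K →+* ℂ, z σ) := mul_le_mul_of_nonneg_left hamgm hnpos.le
    _ = ∑ σ : K →+* ℂ, z σ := by rw [← mul_assoc, mul_one_div_cancel hn0, one_mul]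

/-- **AM–GM minimum bound** (stub `stub_amgm` of line `SketchIdeator5`; the lattice leg's
injectivity certificate). For a nonzero `x` in an ideal `I` of the ring of integers of a number
field `K` of degree `n = [K : ℚ]`, `n · N(I)^{2/n} ≤ ∑_{σ : K → ℂ} |σ x|²`: AM–GM on the `n`
nonnegative reals `|σ x|²` gives `n · (∏_σ |σ x|)^{2/n} ≤ ∑_σ |σ x|²`, and
`N(I) ≤ N((x)) = |N_{K/ℚ}(x)| = ∏_σ |σ x|` because `N(I) ∣ N((x)) ≠ 0`; finally `t ↦ t^{2/n}` is
monotone on `[0, ∞)`. [folklore] -/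
theorem stub_amgm (K : Type*) [Field K] [NumberField K] (I : Ideal (𝓞 K))
    (x : 𝓞 K) (hx : x ∈ I) (hx0 : x ≠ 0) :
    (Module.finrank ℚ K : ℝ) * ((Ideal.absNorm I : ℕ) : ℝ) ^ ((2 : ℝ) / (Module.finrank ℚ K : ℝ))
      ≤ ∑ σ : K →+* ℂ, ‖σ (x : K)‖ ^ 2 := by
  have hN : ((Ideal.absNorm I : ℕ) : ℝ) ≤ ∏ σ : K →+* ℂ, ‖σ (x : K)‖ :=
    absNorm_le_prod_norm_embeddings K I x hx hx0
  have hP : (0 : ℝ) ≤ ∏ σ : K →+* ℂ, ‖σ (x : K)‖ := Finset.prod_nonneg fun σ _ => norm_nonneg _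
  have he : (0 : ℝ) ≤ (2 : ℝ) / (Module.finrank ℚ K : ℝ) := by positivity
  have h1 : ((Ideal.absNorm I : ℕ) : ℝ) ^ ((2 : ℝ) / (Module.finrank ℚ K : ℝ))
      ≤ (∏ σ : K →+* ℂ, ‖σ (x : K)‖) ^ ((2 : ℝ) / (Module.finrank ℚ K : ℝ)) :=
    Real.rpow_le_rpow (Nat.cast_nonneg _) hN he
  have h2 : (∏ σ : K →+* ℂ, ‖σ (x : K)‖) ^ ((2 : ℝ) / (Module.finrank ℚ K : ℝ))
      = (∏ σ : K →+* ℂ, ‖σ (x : K)‖ ^ 2) ^ ((1 : ℝ) / (Module.finrank ℚ K : ℝ)) := by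
    rw [Finset.prod_pow, ← Real.rpow_two, ← Real.rpow_mul hP]
    congr 1
    ring
  calc (Module.finrank ℚ K : ℝ) * ((Ideal.absNorm I : ℕ) : ℝ) ^ ((2 : ℝ) / (Module.finrank ℚ K : ℝ))
      ≤ (Module.finrank ℚ K : ℝ)
          * (∏ σ : K →+* ℂ, ‖σ (x : K)‖) ^ ((2 : ℝ) / (Module.finrank ℚ K : ℝ)) :=
        mul_le_mul_of_nonneg_left h1 (Nat.cast_nonneg _)
    _ = (Module.finrank ℚ K : ℝ)
          * (∏ σ : K →+* ℂ, ‖σ (x : K)‖ ^ 2) ^ ((1 : ℝ) / (Module.finrank ℚ K : ℝ)) := by rw [h2]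
    _ ≤ ∑ σ : K →+* ℂ, ‖σ (x : K)‖ ^ 2 :=
        finrank_mul_prod_rpow_le_sum K (fun σ => ‖σ (x : K)‖ ^ 2) fun σ => by positivity

end Summit.PneNP.PneNP.Theorems.LatticeMagicTarget
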